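import Summits.KontsevichZagierPeriods.KontsevichZagierPeriods.Theorems.MzvKernelInKZ.Negative.PiLine
import Summits.KontsevichZagierPeriods.KontsevichZagierPeriods.Theorems.MzvKernelInKZ.Negative.CalabiTwo

/-!
# `MzvKernelInKZ` (stmt-KontsevichZagierPeriods-3914): negative side — the rational polar chart and the Newton–Leibniz move in the radius

Companion of `Negative/PiLine.lean`, `Negative/CalabiTwo.lean` (the element `[π]`, concluded in `PiDisc.lean`).
The RATIONAL polar chart `(t, s) ↦ s·((1−t²)/(1+t²), 2t/(1+t²))` (`t = tan(θ/2)`, `polar`) is ONE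
change of variables from the open band `ℝ × (0,1)` onto the punctured open disc off the negative axis
(Jacobian `s·g(t)`, injective by `t = sin θ/(1+cos θ)`, onto by the same formula;
`bandORep_sub_discImRep_mem_cov`); the closed band differs by a null set (`bandC_sub_bandO_mem`); and
ONE NEWTON–LEIBNIZ MOVE along the radius with the rational (hence `ℚ`-semialgebraic) primitive
`F(t,s) = s²g(t)/2` integrates the band down to the line `[ℝ, dt/(1+t²)]` (`bandC_sub_line_mem_nl`).

Sources: M. Kontsevich, D. Zagier, *Periods* (2001), §1.1 (the first example `π = ∬_{x²+y²≤1} dx dy = ∫ dx/(1+x²)`), §1.2 (rules (1)–(3)).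
-/

noncomputable section

namespace Summit.KontsevichZagierPeriods.MzvKernelInKZ.Negative

open Set MeasureTheory MvPolynomial
open Literature.NumberTheory.Transcendental
open Literature.ModelTheory.ExponentialFields (IsSemialgebraic)

/-- The open band `{0 < s < 1}` (polar coordinates `(t, s)`, `t = tan(θ/2) ∈ ℝ`). [folklore] -/
def bandO : Set (Fin 2 → ℝ) := {z | 0 < z 1 ∧ z 1 < 1}
/-- The closed band `{0 ≤ s ≤ 1}`. [folklore] -/
def bandC : Set (Fin 2 → ℝ) := {z | 0 ≤ z 1 ∧ z 1 ≤ 1}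

/-- `bandO` is `ℚ`-semialgebraic. [folklore] -/
theorem sa_bandO : IsSemialgebraic ℚ bandO := by
  have e : bandO = {z | 0 < aeval z (X 1 : MvPolynomial (Fin 2) ℚ)} ∩ {z | 0 < aeval z (1 - X 1 : MvPolynomial (Fin 2) ℚ)} := by
    ext z; simp [bandO, sub_pos]
  rw [e]
  exact (Literature.ModelTheory.ExponentialFields.isSemialgebraic_setOf_eval_pos _).inter
    (Literature.ModelTheory.ExponentialFields.isSemialgebraic_setOf_eval_pos _)

/-- `bandC` is `ℚ`-semialgebraic. [folklore] -/
theorem sa_bandC : IsSemialgebraic ℚ bandC := by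
  have e : bandC = {z | 0 ≤ aeval z (X 1 : MvPolynomial (Fin 2) ℚ)} ∩ {z | 0 ≤ aeval z (1 - X 1 : MvPolynomial (Fin 2) ℚ)} := by
    ext z; simp [bandC, sub_nonneg]
  rw [e]
  exact (Literature.ModelTheory.ExponentialFields.isSemialgebraic_setOf_eval_nonneg _).inter
    (Literature.ModelTheory.ExponentialFields.isSemialgebraic_setOf_eval_nonneg _)

/-- The polar integrand `s · g(t)`. [folklore] -/
def polF (z : Fin 2 → ℝ) : ℝ := z 1 * gq (z 0)

/-- `polF` is a `ℚ`-semialgebraic function on its domain. [folklore] -/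
theorem isSemialgebraicFunOn_polF {S : Set (Fin 2 → ℝ)} (hS : IsSemialgebraic ℚ S) : IsSemialgebraicFunOn ℚ S polF := by
  refine (isSemialgebraicFunOn_aeval_div_aeval hS (2 * X 1 : MvPolynomial (Fin 2) ℚ) (1 + X 0 ^ 2) fun z _ => ?_).congr
    fun z _ => ?_
  · simp only [map_add, map_one, map_pow, aeval_X]; exact one_add_sq_ne _
  · simp [polF, gq]; ring

/-- The punctured open disc minus the negative axis (image of the polar chart). [folklore] -/
def discIm : Set (Fin 2 → ℝ) :=
  {p | 0 < p 0 ^ 2 + p 1 ^ 2 ∧ p 0 ^ 2 + p 1 ^ 2 < 1 ∧ ¬ (p 1 = 0 ∧ p 0 ≤ 0)}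

/-- `discIm` is `ℚ`-semialgebraic. [folklore] -/
theorem sa_discIm : IsSemialgebraic ℚ discIm := by
  have e : discIm = ({p | 0 < aeval p (X 0 ^ 2 + X 1 ^ 2 : MvPolynomial (Fin 2) ℚ)} ∩
      {p | 0 < aeval p (1 - (X 0 ^ 2 + X 1 ^ 2) : MvPolynomial (Fin 2) ℚ)}) \
      ({p | aeval p (X 1 : MvPolynomial (Fin 2) ℚ) = 0} ∩ {p | 0 ≤ aeval p (-X 0 : MvPolynomial (Fin 2) ℚ)}) := by
    ext p; simp [discIm, sub_pos]; tauto
  rw [e]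
  exact ((Literature.ModelTheory.ExponentialFields.isSemialgebraic_setOf_eval_pos _).inter
    (Literature.ModelTheory.ExponentialFields.isSemialgebraic_setOf_eval_pos _)).diff
    ((Literature.ModelTheory.ExponentialFields.isSemialgebraic_setOf_eval_eq_zero _).inter
      (Literature.ModelTheory.ExponentialFields.isSemialgebraic_setOf_eval_nonneg _))

/-- The image of the polar chart lies in Kontsevich–Zagier's disc. [folklore] -/
theorem discIm_sub_piDisc : discIm ⊆ KZ.piDisc := fun p hp => by
  rw [KZ.mem_piDisc]; exact hp.2.1.le

/-- `[Im, 1]`, the disc representation restricted to the image of the polar chart. [folklore] -/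
def discImRep : KZ.IntegralRep 2 := KZ.piRep.restrict discIm sa_discIm discIm_sub_piDisc

/-- The rational polar chart `(t, s) ↦ s·(cos θ, sin θ)`, `t = tan(θ/2)`. [folklore] -/
def polar (z : Fin 2 → ℝ) : Fin 2 → ℝ := ![z 1 * Cs (z 0), z 1 * Sn (z 0)]

/-- Its derivative. [folklore] -/
def polarDeriv (z : Fin 2 → ℝ) : (Fin 2 → ℝ) →L[ℝ] (Fin 2 → ℝ) :=
  LinearMap.toContinuousLinearMap (Matrix.toLin'
    !![z 1 * (-(Sn (z 0) * gq (z 0))), Cs (z 0); z 1 * (Cs (z 0) * gq (z 0)), Sn (z 0)])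

/-- The determinant of `polarDeriv`. [folklore] -/
theorem det_polarDeriv (z : Fin 2 → ℝ) : (polarDeriv z).det = -(z 1 * gq (z 0)) := by
  have h : (!![z 1 * (-(Sn (z 0) * gq (z 0))), Cs (z 0); z 1 * (Cs (z 0) * gq (z 0)), Sn (z 0)] :
      Matrix (Fin 2) (Fin 2) ℝ).det = -(z 1 * gq (z 0)) := by
    rw [Matrix.det_fin_two]
    simp only [Matrix.of_apply, Matrix.cons_val', Matrix.cons_val_zero, Matrix.cons_val_one, Matrix.empty_val',
      Matrix.cons_val_fin_one]
    have := Sn_sq_add_Cs_sq (z 0)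
    linear_combination (-(z 1 * gq (z 0))) * this
  rw [← h]; exact LinearMap.det_toLin' _

/-- Differentiability of `polar` with the stated derivative. [folklore] -/
theorem hasFDerivAt_polar (z : Fin 2 → ℝ) : HasFDerivAt polar (polarDeriv z) z := by
  have p0 : HasFDerivAt (fun y : Fin 2 → ℝ => y 0)
      (ContinuousLinearMap.proj (R := ℝ) (φ := fun _ : Fin 2 => ℝ) 0) z := hasFDerivAt_apply 0 z
  have p1 : HasFDerivAt (fun y : Fin 2 → ℝ => y 1)
      (ContinuousLinearMap.proj (R := ℝ) (φ := fun _ : Fin 2 => ℝ) 1) z := hasFDerivAt_apply 1 z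
  have s0 := (hasDerivAt_Sn (z 0)).comp_hasFDerivAt z p0
  have c0' := (hasDerivAt_Cs (z 0)).comp_hasFDerivAt z p0
  have c0 : HasFDerivAt (fun y : Fin 2 → ℝ => polar y 0) ((ContinuousLinearMap.proj 0).comp (polarDeriv z)) z := by
    refine (p1.mul c0').congr_fderiv ?_
    ext v; simp [polarDeriv, dotProduct, Fin.sum_univ_two, Function.comp]; ring
  have c1 : HasFDerivAt (fun y : Fin 2 → ℝ => polar y 1) ((ContinuousLinearMap.proj 1).comp (polarDeriv z)) z := by
    refine (p1.mul s0).congr_fderiv ?_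
    ext v; simp [polarDeriv, dotProduct, Fin.sum_univ_two, Function.comp]; ring
  rw [hasFDerivAt_pi']
  intro i; fin_cases i
  · exact c0
  · exact c1

/-- `1 + cos θ ≠ 0` for every real half-angle. [folklore] -/
theorem one_add_Cs_ne (t : ℝ) : 1 + Cs t ≠ 0 := by
  have : 1 + Cs t = 2 / (1 + t ^ 2) := by
    have := one_add_sq_ne t; simp only [Cs]; field_simp; ring
  rw [this]; exact div_ne_zero two_ne_zero (one_add_sq_ne t)

/-- The half-angle is recovered from the point on the circle: `t = sin θ / (1 + cos θ)`. [folklore] -/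
theorem halfAngle_eq (t : ℝ) : t = Sn t / (1 + Cs t) := by
  have h1 := one_add_Cs_ne t
  have h2 := one_add_sq_ne t
  rw [eq_div_iff h1]
  simp only [Sn, Cs]
  field_simp
  ring

/-- `|polar(t,s)|² = s²`. [folklore] -/
theorem polar_normSq (z : Fin 2 → ℝ) : (polar z 0) ^ 2 + (polar z 1) ^ 2 = z 1 ^ 2 := by
  simp only [polar, Matrix.cons_val_zero, Matrix.cons_val_one]
  have := Sn_sq_add_Cs_sq (z 0)
  linear_combination (z 1 ^ 2) * this

/-- `polar` is injective on its domain. [folklore] -/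
theorem injOn_polar : InjOn polar bandO := by
  intro z hz z' hz' h
  have n := polar_normSq z
  have n' := polar_normSq z'
  rw [h] at n
  have e1 : z 1 = z' 1 := by nlinarith [hz.1, hz'.1]
  have h0 : polar z 0 = polar z' 0 := congrFun h 0
  have h1 : polar z 1 = polar z' 1 := congrFun h 1
  simp only [polar, Matrix.cons_val_zero, Matrix.cons_val_one, e1] at h0 h1
  have hc : Cs (z 0) = Cs (z' 0) := mul_left_cancel₀ hz'.1.ne' h0
  have hs : Sn (z 0) = Sn (z' 0) := mul_left_cancel₀ hz'.1.ne' h1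
  have e0 : z 0 = z' 0 := by rw [halfAngle_eq (z 0), halfAngle_eq (z' 0), hc, hs]
  funext i; fin_cases i
  · exact e0
  · exact e1

/-- The polar chart maps the open band into the punctured disc off the negative axis. [folklore] -/
theorem polar_mem_discIm {z : Fin 2 → ℝ} (hz : z ∈ bandO) : polar z ∈ discIm := by
  obtain ⟨s0, s1⟩ := hz
  refine ⟨by rw [polar_normSq]; positivity, by rw [polar_normSq]; nlinarith, ?_⟩
  rintro ⟨h1, h0⟩
  simp only [polar, Matrix.cons_val_zero, Matrix.cons_val_one] at h0 h1
  have hs : Sn (z 0) = 0 := by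
    rcases mul_eq_zero.mp h1 with h | h
    · linarith
    · exact h
  have ht : z 0 = 0 := by
    have := one_add_sq_ne (z 0)
    simp only [Sn, div_eq_zero_iff] at hs
    rcases hs with hs | hs
    · linarith
    · exact absurd hs this
  rw [ht] at h0
  simp [Cs] at h0
  linarith

/-- The image of the domain under `polar`. [folklore] -/
theorem image_polar : polar '' bandO = discIm := by
  apply Subset.antisymm
  · rintro _ ⟨z, hz, rfl⟩; exact polar_mem_discIm hz
  · rintro p ⟨hpos, hlt, hax⟩
    set s := Real.sqrt (p 0 ^ 2 + p 1 ^ 2) with hs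
    have s_pos : 0 < s := Real.sqrt_pos.mpr hpos
    have s_sq : s ^ 2 = p 0 ^ 2 + p 1 ^ 2 := Real.sq_sqrt hpos.le
    have s_lt : s < 1 := by nlinarith
    set c := p 0 / s with hc
    set d := p 1 / s with hd
    have cd : c ^ 2 + d ^ 2 = 1 := by
      rw [hc, hd, div_pow, div_pow, ← add_div, ← s_sq, div_self (by positivity)]
    have hc1 : 1 + c ≠ 0 := by
      intro h
      have c1 : c = -1 := by linarith
      have d0 : d = 0 := by nlinarith
      have p1z : p 1 = 0 := by
        rw [hd, div_eq_zero_iff] at d0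
        rcases d0 with h | h
        · exact h
        · linarith
      have p0n : p 0 ≤ 0 := by
        have : p 0 = c * s := by rw [hc]; field_simp
        rw [this, c1]; linarith
      exact hax ⟨p1z, p0n⟩
    set t := d / (1 + c) with ht
    have key1 : 1 + t ^ 2 = 2 / (1 + c) := by
      rw [ht]; field_simp; nlinarith [cd]
    have hCs : Cs t = c := by
      simp only [Cs]; rw [key1, ht]; field_simp; nlinarith [cd]
    have hSn : Sn t = d := by
      simp only [Sn]; rw [key1, ht]; field_simp
    refine ⟨![t, s], ⟨by simpa using s_pos, by simpa using s_lt⟩, ?_⟩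
    funext i; fin_cases i
    · simp [polar, hCs, hc]; field_simp
    · simp [polar, hSn, hd]; field_simp

/-- `polar` is a `ℚ`-semialgebraic map on its domain (rational or polynomial components). [folklore] -/
theorem isSemialgebraicMapOn_polar : IsSemialgebraicMapOn ℚ bandO polar := by
  refine IsSemialgebraicMapOn.of_forall sa_bandO fun j => ?_
  fin_cases j
  · refine (isSemialgebraicFunOn_aeval_div_aeval sa_bandO (X 1 * (1 - X 0 ^ 2) : MvPolynomial (Fin 2) ℚ)
      (1 + X 0 ^ 2) fun z _ => ?_).congr fun z _ => ?_
    · simp only [map_add, map_one, map_pow, aeval_X]; exact one_add_sq_ne _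
    · simp [polar, Cs]; ring
  · refine (isSemialgebraicFunOn_aeval_div_aeval sa_bandO (X 1 * (2 * X 0) : MvPolynomial (Fin 2) ℚ)
      (1 + X 0 ^ 2) fun z _ => ?_).congr fun z _ => ?_
    · simp only [map_add, map_one, map_pow, aeval_X]; exact one_add_sq_ne _
    · simp [polar, Sn]; ring

/-- `[band, s·g(t)]`, integrability transported from the disc through the polar chart. [folklore] -/
def bandORep : KZ.IntegralRep 2 where
  domain := bandO
  integrand := polF
  isSemialgebraic_domain := sa_bandO
  isSemialgebraicFunOn_integrand := isSemialgebraicFunOn_polF sa_bandO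
  integrableOn := by
    have h := (integrableOn_image_iff_integrableOn_abs_det_fderiv_smul volume sa_bandO.measurableSet_holds
      (fun z _ => (hasFDerivAt_polar z).hasFDerivWithinAt) injOn_polar (fun _ : Fin 2 → ℝ => (1 : ℝ))).mp
      (by rw [image_polar]; exact discImRep.integrableOn)
    refine h.congr_fun (fun z hz => ?_) sa_bandO.measurableSet_holds
    dsimp only
    rw [det_polarDeriv, abs_neg, abs_of_pos (mul_pos hz.1 (gq_pos _)), smul_eq_mul, mul_one]; rfl

/-- **The polar chart is ONE change of variables**: `[band, s·g(t)] − [Im, 1]`. [folklore] -/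
theorem bandORep_sub_discImRep_mem_cov : KZ.of bandORep - KZ.of discImRep ∈ KZ.changeOfVariablesRel := by
  refine ⟨2, bandORep, discImRep, polar, fun z => polarDeriv z, isSemialgebraicMapOn_polar,
    fun z _ => (hasFDerivAt_polar z).hasFDerivWithinAt, injOn_polar, image_polar.symm, fun z hz => ?_, rfl⟩
  change polF z = 1 * |(polarDeriv z).det|
  rw [det_polarDeriv, abs_neg, abs_of_pos (mul_pos hz.1 (gq_pos _)), one_mul]; rfl

/-- The closed band exceeds the open band by a null set. [folklore] -/
theorem volume_bandC_diff : volume (bandC \ bandO) = 0 := by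
  have hsub : bandC \ bandO ⊆ {z : Fin 2 → ℝ | z 1 = 0} ∪ {z | z 1 = 1} := by
    rintro z ⟨⟨h0, h1⟩, hn⟩
    simp only [bandO, mem_setOf_eq, not_and, not_lt] at hn
    simp only [mem_union, mem_setOf_eq]
    rcases h0.lt_or_eq with h | h
    · right; exact le_antisymm h1 (hn h)
    · left; exact h.symm
  have hz : ∀ a : ℝ, volume {z : Fin 2 → ℝ | z 1 = a} = 0 := fun a => by
    have e : {z : Fin 2 → ℝ | z 1 = a} = Set.pi univ (fun i : Fin 2 => if i = 1 then ({a} : Set ℝ) else univ) := by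
      ext z; simp
    rw [e, volume_pi_pi, Fin.prod_univ_two]
    simp
  exact measure_mono_null hsub (measure_union_null (hz 0) (hz 1))

/-- Horizontal lines of `ℝ²` are null. [folklore] -/
theorem volume_line2 (a : ℝ) : volume {z : Fin 2 → ℝ | z 1 = a} = 0 := by
  have e : {z : Fin 2 → ℝ | z 1 = a} = Set.pi univ (fun i : Fin 2 => if i = 1 then ({a} : Set ℝ) else univ) := by
    ext z; simp
  rw [e, volume_pi_pi, Fin.prod_univ_two]
  simp

/-- `[closed band, s·g(t)]`. [folklore] -/
def bandCRep : KZ.IntegralRep 2 where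
  domain := bandC
  integrand := polF
  isSemialgebraic_domain := sa_bandC
  isSemialgebraicFunOn_integrand := isSemialgebraicFunOn_polF sa_bandC
  integrableOn := by
    have hsub : bandO ⊆ bandC := fun z hz => ⟨hz.1.le, hz.2.le⟩
    have e : bandC = bandO ∪ (bandC \ bandO) := (Set.union_sdiff_cancel hsub).symm
    rw [e]
    refine bandORep.integrableOn.union ?_
    rw [IntegrableOn, Measure.restrict_eq_zero.mpr volume_bandC_diff]
    exact integrable_zero_measure

/-- `[closed band] − [open band] − [null]`: one domain additivity. [folklore] -/
theorem bandC_sub_bandO_mem : KZ.of bandCRep - KZ.of bandORep ∈ KZ.relations := by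
  have hsub : bandO ⊆ bandC := fun z hz => ⟨hz.1.le, hz.2.le⟩
  let N : KZ.IntegralRep 2 := bandCRep.restrict (bandC \ bandO) (sa_bandC.diff sa_bandO) Set.sdiff_subset
  have h1 : KZ.of bandCRep - KZ.of bandORep - KZ.of N ∈ KZ.relations := by
    refine KZ.domainAddRel_subset_relations ⟨2, bandCRep, bandORep, N, ?_, ?_, fun _ _ => rfl, fun _ _ => rfl, rfl⟩
    · change bandC = bandO ∪ (bandC \ bandO); rw [Set.union_sdiff_cancel hsub]
    · change volume (bandO ∩ (bandC \ bandO)) = 0; rw [Set.inter_sdiff_self, measure_empty]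
  have h2 : KZ.of N ∈ KZ.relations :=
    KZ.levelRel_le_relations (KZ.of_mem_levelRel_of_volume_eq_zero _ volume_bandC_diff)
  have : KZ.of bandCRep - KZ.of bandORep = (KZ.of bandCRep - KZ.of bandORep - KZ.of N) + KZ.of N := by abel
  rw [this]; exact add_mem h1 h2

/-- `Fin.snoc x t 0 = x 0` on `ℝ¹`. [folklore] -/
theorem snoc2_zero (x : Fin 1 → ℝ) (t : ℝ) : (Fin.snoc x t : Fin 2 → ℝ) 0 = x 0 := by
  simp [Fin.snoc]
/-- `Fin.snoc x t 1 = t` on `ℝ¹`. [folklore] -/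
theorem snoc2_one (x : Fin 1 → ℝ) (t : ℝ) : (Fin.snoc x t : Fin 2 → ℝ) 1 = t := by
  simp [Fin.snoc]

/-- **ONE NEWTON–LEIBNIZ MOVE** integrates out the radius: `[band, s·g(t)] − [ℝ, g(t)/2]`, primitive
`F(t,s) = s²g(t)/2` (rational, hence `ℚ`-semialgebraic). [folklore] -/
theorem bandC_sub_line_mem_nl : KZ.of bandCRep - KZ.of (lineRep univ sa_univ1) ∈ KZ.newtonLeibnizRel := by
  refine ⟨1, bandCRep, lineRep univ sa_univ1, fun _ => 0, fun _ => 1,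
    fun z => z 1 ^ 2 / 2 * gq (z 0), ?_, ?_, ?_, fun _ _ => zero_le_one, ?_, fun x _ => ?_, fun x _ t _ => ?_,
    fun x _ => ?_, rfl⟩
  · refine (isSemialgebraicFunOn_aeval_div_aeval sa_bandC (X 1 ^ 2 : MvPolynomial (Fin 2) ℚ) (1 + X 0 ^ 2)
      fun z _ => ?_).congr fun z _ => ?_
    · simp only [map_add, map_one, map_pow, aeval_X]; exact one_add_sq_ne _
    · have := one_add_sq_ne (z 0)
      simp [gq]
      field_simp
  · show IsSemialgebraicFunOn ℚ (univ : Set (Fin 1 → ℝ)) fun _ => (0 : ℝ)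
    simpa using isSemialgebraicFunOn_aeval sa_univ1 (0 : MvPolynomial (Fin 1) ℚ)
  · show IsSemialgebraicFunOn ℚ (univ : Set (Fin 1 → ℝ)) fun _ => (1 : ℝ)
    simpa using isSemialgebraicFunOn_aeval sa_univ1 (1 : MvPolynomial (Fin 1) ℚ)
  · ext z
    change z ∈ bandC ↔ Fin.init z ∈ (univ : Set (Fin 1 → ℝ)) ∧ 0 ≤ z (Fin.last 1) ∧ z (Fin.last 1) ≤ 1
    simp only [mem_univ, true_and]
    rfl
  · have : (fun t : ℝ => (Fin.snoc x t : Fin 2 → ℝ) 1 ^ 2 / 2 * gq ((Fin.snoc x t : Fin 2 → ℝ) 0)) =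
        fun t => t ^ 2 / 2 * gq (x 0) := by
      funext t; rw [snoc2_zero, snoc2_one]
    rw [this]
    exact ((continuous_pow 2).div_const _ |>.mul continuous_const).continuousOn
  · have e : (fun s : ℝ => (Fin.snoc x s : Fin 2 → ℝ) 1 ^ 2 / 2 * gq ((Fin.snoc x s : Fin 2 → ℝ) 0)) =
        fun s => s ^ 2 / 2 * gq (x 0) := by
      funext s; rw [snoc2_zero, snoc2_one]
    rw [e]
    change HasDerivAt (fun s => s ^ 2 / 2 * gq (x 0)) (polF (Fin.snoc x t)) t
    have : polF (Fin.snoc x t) = t * gq (x 0) := by simp only [polF]; rw [snoc2_zero, snoc2_one]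
    rw [this]
    have h := ((hasDerivAt_pow 2 t).div_const 2).mul_const (gq (x 0))
    exact h.congr_deriv (by norm_num)
  · change hq (x 0) = (Fin.snoc x (1 : ℝ) : Fin 2 → ℝ) 1 ^ 2 / 2 * gq ((Fin.snoc x (1 : ℝ) : Fin 2 → ℝ) 0) -
      (Fin.snoc x (0 : ℝ) : Fin 2 → ℝ) 1 ^ 2 / 2 * gq ((Fin.snoc x (0 : ℝ) : Fin 2 → ℝ) 0)
    rw [snoc2_zero, snoc2_one, snoc2_zero, snoc2_one, hq_eq]
    ring

end Summit.KontsevichZagierPeriods.MzvKernelInKZ.Negative
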